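import Mathlib.Analysis.Complex.Basic
import Mathlib.Data.Set.Finite.Lemmas
import HarnessLib

/-!
# Slit necklace, step D4: a finite `s / 2`-net of centres on a closed ball of `ℂ`

Crux `SAWLeftRightFKG.FKGToTraversalBound` (stmt-CriticalPhenomena-1878), line `slit-necklace`,
registered helper stub `exists_centre_net` of `stub_necklaceAssembly`: the net of centres fed to
`hasTraversals_subshell_pigeonhole`.

Elementary compactness.  The closed ball `closedBall x R` of `ℂ` is compact (`ℂ` is a proper
metric space), so it is covered by finitely many open balls of radius `s / 2` centred at points of
the ball (`finite_cover_balls_of_compact`); enumerating the finite set of centres by `Fin N`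
(`Set.Finite.fin_embedding`) gives the net.  For `R < 0` the ball is empty and `N = 0`.

Only theorems; axioms are the standard three.
-/

noncomputable section

open Set Metric

namespace Summit.CriticalPhenomena.SAWScalingLimit.Theorems.FKGToTraversalBound.SlitNecklace

/-- **Finite net of centres.**  For every `x : ℂ`, every radius `R` and every `s > 0` there are
finitely many centres `c₀, …, c_{N-1}` such that every point of the closed `R`-ball about `x` is
within `s / 2` of some `cᵢ` (compactness of closed balls in `ℂ`). [folklore] -/
theorem exists_centre_net : ∀ (x : ℂ) (R s : ℝ), 0 < s → ∃ (N : ℕ) (c : Fin N → ℂ),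
    ∀ m : ℂ, dist m x ≤ R → ∃ i : Fin N, dist m (c i) ≤ s / 2 := by
  intro x R s hs
  obtain ⟨t, -, htfin, hcov⟩ :=
    finite_cover_balls_of_compact (isCompact_closedBall x R) (half_pos hs)
  obtain ⟨N, f, hf⟩ := htfin.fin_embedding
  refine ⟨N, f, fun m hm => ?_⟩
  obtain ⟨y, hy, hmy⟩ := mem_iUnion₂.1 (hcov (mem_closedBall.2 hm))
  rw [← hf] at hy
  obtain ⟨i, rfl⟩ := hy
  exact ⟨i, (mem_ball.1 hmy).le⟩

end Summit.CriticalPhenomena.SAWScalingLimit.Theorems.FKGToTraversalBound.SlitNecklace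

end
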